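import Summits.QuantumFields.GaugeBoot.DiagonalRPTorusLineCuts
import Summits.QuantumFields.GaugeBoot.DiagonalRPTorusInnerHalf
import HarnessLib

/-!
# Inner-half diagonal RP FAILS on every even three-torus `L ≥ 6`, uniformly in the size
(gauge-boot, task L3(ν), companion 2/2)

HONEST FRAMING (cell `pub-gaugeboot`, page 1 of every file): the venture produces certified bounds
on lattice expectations at stated coupling, gauge group, dimension and torus size; NOT a mass gap,
NOT a continuum limit, NOT a string tension; NOT Yang–Mills-summit-bearing (barriers
`FixedCouplingUltralocality`, `PerturbativeInvisibility`). This module is a structural NEGATIVE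
result about a positivity constraint on finite tori (`d = 3`, every even `L ≥ 6`) for gauge
groups carrying a sign character; it discharges nothing else.

## Content

On EVEN tori the closed diagonal half has a back layer and closed-half diagonal RP fails in every
`d ≥ 3` at every `β` (`DiagonalRPTorusNegative`, L3(γ)); off the back layer,
`DiagonalRPTorusInnerHalf` (L3(η)) proves INNER-half diagonal RP `InnerDiagonalRP ρ β i j` on
every even TWO-torus `L ≥ 4` for every compact group and `β ≥ 0`, and its docstring (with
`DiagonalRPTorusNegative`, "observables supported strictly inside the half: not covered") leaves
the inner half in `d ≥ 3` open. Here: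

* **`DiagRPThree.not_innerDiagonalRP_even`** — for `d = 3`, EVERY even `L ≥ 6`, the swap of the
  coordinates `0, 1`, every compact group `G`, every continuous one-dimensional representation
  `ρ` with values in `{1, -1}` attaining `-1`, and every `0 < β ≤ 1/5000` (ONE window for all
  `L`): `¬ InnerDiagonalRP (d := 3) (L := L) ρ β 0 1`;
* **`DiagRPThree.not_innerDiagonalRP_even_intUnits`** — the `ℤ₂` lattice gauge theory instance.

With `DiagonalRPTorusNegativeOdd` this closes the finite-torus route to a three-dimensional
Class-B statement at both parities: neither the closed half on odd tori nor the inner half on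
even tori is reflection positive for the diagonal swap, at any size, already for `ℤ₂`.

## Mechanism

`L = 2c`, columns `X = (c-1, 0)` and `Y = (-2, c-1)` at diagonal level `c - 1 < c = L/2` (inner
half); `θX = (0, c-1) = Y + 2e₀`, `θY = (c-1, -2) = X - 2e₁`. With `F = P_X - P_Y`
(`wilsonExpectation_polDiff`): the two-ladder bands give `K(θX,Y), K(θY,X) ≥ t^{2L} 𝐙`
(`ladder_boundary` twice, symmetric difference, `pow_mul_ksum_le`); `θX - X = (1-c, c-1)` and
`θY - Y = (c+1, -(c+1))` have both coordinates outside `{0, ±1}` (`c ≥ 3`), so the `4L` line cuts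
of `DiagonalRPTorusLineCuts.four_mul_le_card` give `K(θX,X), K(θY,Y) ≤ (44t)^{4L} e^L 𝐙`
(`ksum_le_polymer`); `44⁴ e t² < 1` for `t ≤ 1/4000`.

## What is NOT claimed

Nothing about `β > 1/5000`, nothing about `L = 4` (the distances tie), nothing about `L = 2`,
nothing about groups without a sign character, nothing about infinite volume (where diagonal RP
holds, `DiagonalRPFiniteVolume`, and Class B at small `β` is known, `ClassBStrongCoupling`).

Sources: Osterwalder–Seiler, Ann. Phys. 110 (1978) 440, §§2–3; Kazakov–Zheng, arXiv:2203.11360 §3.1.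
Elementary; not in print as theorems as far as the cell's searches go.
Printed precedent (nearest-neighbour spin systems, a remark without proof): periodic boundary conditions destroy
diagonal RP — Fröhlich–Israel–Lieb–Simon, J. Stat. Phys. 22 (1980) 297, §3 (Model 3.1); M. Biskup, in LNM 1970
(2009) §5.5; the statements here are theorem-level, gauge-theoretic forms of that obstruction (tribunal t2 F-R1).
-/

open MeasureTheory Complex Finset
open scoped ComplexOrder symmDiff

namespace Summit.QuantumFields.GaugeBoot

open Literature.MathematicalPhysics.QuantumFieldTheory

namespace DiagRPThree

section Even

variable {L : ℕ} [NeZero L]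

omit [NeZero L] in
/-- **Boundaries add under symmetric difference**: if `∂S = A + M` and `∂T = M + B` then
`∂(S Δ T) = A + B`. -/
theorem boundary_symmDiff {S T : Finset (Plaquette 3 L)} {A M B : ZMod L × ZMod L}
    (hS : ∀ e, Even (degS S e + ccnt A e + ccnt M e))
    (hT : ∀ e, Even (degS T e + ccnt M e + ccnt B e)) (e : Edge 3 L) :
    Even (degS (S ∆ T) e + ccnt A e + ccnt B e) := by
  have h3 := degS_symmDiff_add S T e
  have h4 : Even (degS (S ∆ T) e + ccnt A e + ccnt B e + 2 * (degS (S ∩ T) e + ccnt M e)) := by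
    rw [show degS (S ∆ T) e + ccnt A e + ccnt B e + 2 * (degS (S ∩ T) e + ccnt M e) =
      (degS (S ∆ T) e + 2 * degS (S ∩ T) e) + ccnt A e + ccnt B e + ccnt M e + ccnt M e by ring,
      h3, show degS S e + degS T e + ccnt A e + ccnt B e + ccnt M e + ccnt M e =
      (degS S e + ccnt A e + ccnt M e) + (degS T e + ccnt M e + ccnt B e) by ring]
    exact (hS e).add (hT e)
  exact (Nat.even_add.1 h4).2 (even_two_mul _)

/-- **A two-ladder band**: `K(bump a (bump a B), B)`-type lower bound. If `pl = (a, 2)`, the band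
of the two ladders over `B` and `B + e_a` has boundary `column B + column (B + 2e_a)` and at most
`2L` plaquettes, so `t^{2L} 𝐙 ≤ K(B, B + 2e_a)`. -/
theorem band_lower {t : ℝ} (ht0 : 0 ≤ t) (ht1 : t ≤ 1) (B : ZMod L × ZMod L)
    (pl : {q : Fin 3 × Fin 3 // q.1 < q.2}) (hpl : pl.1.2 = 2) (C : ZMod L × ZMod L) :
    t ^ (2 * L) * ksum t C C ≤ ksum t B (bump pl.1.1 (bump pl.1.1 B)) := by
  have hb := boundary_symmDiff (ladder_boundary B pl hpl) (ladder_boundary (bump pl.1.1 B) pl hpl)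
  have hcard : (ladder B pl ∆ ladder (bump pl.1.1 B) pl).card ≤ 2 * L :=
    calc (ladder B pl ∆ ladder (bump pl.1.1 B) pl).card
        ≤ (ladder B pl ∪ ladder (bump pl.1.1 B) pl).card := card_le_card symmDiff_subset_union
      _ ≤ (ladder B pl).card + (ladder (bump pl.1.1 B) pl).card := card_union_le _ _
      _ ≤ L + L := add_le_add (card_ladder_le _ _) (card_ladder_le _ _)
      _ = 2 * L := by ring
  exact le_trans (mul_le_mul_of_nonneg_right (pow_le_pow_of_le_one ht0 ht1 hcard)
    (ksum_nonneg ht0 _ _)) (pow_mul_ksum_le ht0 ht1 C hb)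

/-- `K` is symmetric in the two columns. -/
theorem ksum_comm (t : ℝ) (A B : ZMod L × ZMod L) : ksum t A B = ksum t B A := by
  unfold ksum jind
  simp only [add_right_comm]

/-! ### The even torus `L = 2c`, `c ≥ 3` -/

/-- The witness columns on the even torus `L = 2c`: `X = (c-1, 0)` … -/
def colXe (c : ℕ) : ZMod L × ZMod L := ((c : ZMod L) - 1, 0)

/-- … and `Y = (-2, c-1)`; `θX = Y + 2e₀`, `X = θY + 2e₁`. -/
def colYe (c : ℕ) : ZMod L × ZMod L := (-2, (c : ZMod L) - 1)

/-- `K(θX, Y) ≥ t^{2L} 𝐙` (band of the plane `(0,2)` over `Y`, `Y + e₀`). -/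
theorem cross_lower_Xe {t : ℝ} (ht0 : 0 ≤ t) (ht1 : t ≤ 1) (c : ℕ) (C : ZMod L × ZMod L) :
    t ^ (2 * L) * ksum t C C ≤ ksum t (colXe (L := L) c).swap (colYe c) := by
  have hb : bump 0 (bump 0 (colYe (L := L) c)) = (colXe (L := L) c).swap := by
    refine Prod.ext ?_ ?_
    · show (-2 : ZMod L) + (if (0 : Fin 3) = 0 then 1 else 0) + (if (0 : Fin 3) = 0 then 1 else 0) = 0
      rw [if_pos rfl]
      ring
    · show ((c : ZMod L) - 1) + (if (0 : Fin 3) = 1 then 1 else 0) +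
        (if (0 : Fin 3) = 1 then 1 else 0) = (c : ZMod L) - 1
      rw [if_neg (by decide)]
      ring
  rw [ksum_comm t (colXe (L := L) c).swap (colYe c), ← hb]
  exact band_lower ht0 ht1 _ plane02 rfl C

/-- `K(θY, X) ≥ t^{2L} 𝐙` (band of the plane `(1,2)` over `θY`, `θY + e₁`). -/
theorem cross_lower_Ye {t : ℝ} (ht0 : 0 ≤ t) (ht1 : t ≤ 1) (c : ℕ) (C : ZMod L × ZMod L) :
    t ^ (2 * L) * ksum t C C ≤ ksum t (colYe (L := L) c).swap (colXe c) := by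
  have hb : bump 1 (bump 1 (colYe (L := L) c).swap) = colXe (L := L) c := by
    refine Prod.ext ?_ ?_
    · show ((c : ZMod L) - 1) + (if (1 : Fin 3) = 0 then 1 else 0) +
        (if (1 : Fin 3) = 0 then 1 else 0) = (c : ZMod L) - 1
      rw [if_neg (by decide)]
      ring
    · show (-2 : ZMod L) + (if (1 : Fin 3) = 1 then 1 else 0) + (if (1 : Fin 3) = 1 then 1 else 0) = 0
      rw [if_pos rfl]
      ring
  rw [← hb]
  exact band_lower ht0 ht1 _ plane12 rfl C

omit [NeZero L] in
/-- On the even torus `L = 2c`: the residues of `1 ≤ k < 2c` are non-zero. -/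
theorem coe_ne_zero_even (c : ℕ) (hL : L = 2 * c) {k : ℕ} (hk1 : 1 ≤ k) (hk2 : k < 2 * c) :
    ((k : ℕ) : ZMod L) ≠ 0 := by
  intro h
  rw [ZMod.natCast_eq_zero_iff] at h
  have := Nat.le_of_dvd (by omega) h
  omega

omit [NeZero L] in
/-- The separation hypotheses of `four_mul_le_card` for a pair of columns whose coordinate
differences are `±(c - 1)`… stated for a general difference `D` with `D`, `D - 1`, `D + 1`
non-zero. -/
theorem sep_of_ne {a b D : ZMod L} (hD : a - b = D) (h0 : D ≠ 0) (hp : D - 1 ≠ 0)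
    (hm : D + 1 ≠ 0) : a ≠ b ∧ a ≠ b + 1 ∧ a + 1 ≠ b := by
  refine ⟨fun h => h0 ?_, fun h => hp ?_, fun h => hm ?_⟩
  · rw [← hD, h, sub_self]
  · rw [← hD, h]; ring
  · rw [← hD, ← h]; ring

/-- `K(θX, X) ≤ (44t)^{4L} e^L 𝐙`: `θX - X = (1 - c, c - 1)`, both coordinates outside
`{0, ±1}` for `c ≥ 3`. -/
theorem diag_upper_Xe {t : ℝ} (ht0 : 0 ≤ t) (ht1 : t ≤ 1 / 44) (c : ℕ) (hL : L = 2 * c)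
    (hc : 3 ≤ c) (C : ZMod L × ZMod L) :
    ksum t (colXe (L := L) c).swap (colXe c) ≤ (44 * t) ^ (4 * L) * Real.exp L * ksum t C C := by
  have h1 : ((c - 1 : ℕ) : ZMod L) ≠ 0 := coe_ne_zero_even c hL (by omega) (by omega)
  have h2 : ((c - 2 : ℕ) : ZMod L) ≠ 0 := coe_ne_zero_even c hL (by omega) (by omega)
  have h3 : ((c : ℕ) : ZMod L) ≠ 0 := coe_ne_zero_even c hL (by omega) (by omega)
  have hc1 : ((c - 1 : ℕ) : ZMod L) = (c : ZMod L) - 1 := by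
    rw [Nat.cast_sub (by omega), Nat.cast_one]
  have hc2 : ((c - 2 : ℕ) : ZMod L) = (c : ZMod L) - 2 := by
    rw [Nat.cast_sub (by omega), Nat.cast_two]
  refine ksum_le_polymer (fun S hS => four_mul_le_card (fun j hj => ?_) hS) ht0 ht1 C
  rcases hj with rfl | rfl
  · -- coordinate 0: `0 - (c - 1) = 1 - c`
    refine sep_of_ne (D := 1 - (c : ZMod L)) (by simp [coordOf, colXe]) ?_ ?_ ?_
    · intro h; apply h1; rw [hc1]; linear_combination -h
    · intro h; apply h3; linear_combination -h
    · intro h; apply h2; rw [hc2]; linear_combination -h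
  · -- coordinate 1: `(c - 1) - 0 = c - 1`
    refine sep_of_ne (D := (c : ZMod L) - 1) (by simp [coordOf, colXe]) ?_ ?_ ?_
    · rwa [← hc1]
    · intro h; apply h2; rw [hc2]; linear_combination h
    · intro h; apply h3; linear_combination h

/-- `K(θY, Y) ≤ (44t)^{4L} e^L 𝐙`: `θY - Y = (c + 1, -(c + 1))`, both coordinates outside
`{0, ±1}` for `c ≥ 3` (`c + 2 < 2c`). -/
theorem diag_upper_Ye {t : ℝ} (ht0 : 0 ≤ t) (ht1 : t ≤ 1 / 44) (c : ℕ) (hL : L = 2 * c)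
    (hc : 3 ≤ c) (C : ZMod L × ZMod L) :
    ksum t (colYe (L := L) c).swap (colYe c) ≤ (44 * t) ^ (4 * L) * Real.exp L * ksum t C C := by
  have h1 : ((c + 1 : ℕ) : ZMod L) ≠ 0 := coe_ne_zero_even c hL (by omega) (by omega)
  have h2 : ((c + 2 : ℕ) : ZMod L) ≠ 0 := coe_ne_zero_even c hL (by omega) (by omega)
  have h3 : ((c : ℕ) : ZMod L) ≠ 0 := coe_ne_zero_even c hL (by omega) (by omega)
  push_cast at h1 h2
  refine ksum_le_polymer (fun S hS => four_mul_le_card (fun j hj => ?_) hS) ht0 ht1 C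
  rcases hj with rfl | rfl
  · -- coordinate 0: `(c - 1) - (-2) = c + 1`
    refine sep_of_ne (D := (c : ZMod L) + 1) (by simp [coordOf, colYe]; ring) h1 ?_ ?_
    · intro h; apply h3; linear_combination h
    · intro h; apply h2; linear_combination h
  · -- coordinate 1: `-2 - (c - 1) = -(c + 1)`
    refine sep_of_ne (D := -((c : ZMod L) + 1)) (by simp [coordOf, colYe]; ring) ?_ ?_ ?_
    · intro h; apply h1; linear_combination -h
    · intro h; apply h2; linear_combination -h
    · intro h; apply h3; linear_combination -h

/-- **The sign of the combination**, uniformly in `L ≥ 1`: for `0 < t ≤ 1/4000`,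
`(44t)^{4L} e^L < t^{2L}` (`44⁴ e t² < 1`), hence
`K(θX,X) - K(θX,Y) - K(θY,X) + K(θY,Y) < 0`. -/
theorem combination_neg_even {t : ℝ} (ht0 : 0 < t) (ht1 : t ≤ 1 / 4000) (c : ℕ)
    (hL : L = 2 * c) (hc : 3 ≤ c) :
    ksum t (colXe (L := L) c).swap (colXe c) - ksum t (colXe (L := L) c).swap (colYe c) -
        ksum t (colYe (L := L) c).swap (colXe c) + ksum t (colYe (L := L) c).swap (colYe c) <
      0 := by
  have hL1 : 1 ≤ L := by omega
  set Z := ksum t (colXe (L := L) c) (colXe c) with hZ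
  have hZpos : 0 < Z := by
    have h := pow_card_le_ksum (L := L) (t := t) ht0.le (A := colXe c) (B := colXe c) (S₀ := ∅)
      (fun e => by unfold degS; rw [sum_empty, zero_add, ← two_mul]; exact even_two_mul _)
    rw [card_empty, pow_zero] at h
    linarith
  have ht44 : t ≤ 1 / 44 := by linarith
  have h1 := diag_upper_Xe ht0.le ht44 c hL hc (colXe (L := L) c)
  have h2 := diag_upper_Ye ht0.le ht44 c hL hc (colXe (L := L) c)
  have h3 := cross_lower_Xe ht0.le (by linarith) c (colXe (L := L) c)
  have h4 := cross_lower_Ye ht0.le (by linarith) c (colXe (L := L) c)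
  -- `(44 t)^{4L} e^L < t^{2L}`
  have hsmall : (44 * t) ^ (4 * L) * Real.exp L < t ^ (2 * L) := by
    have he := Real.exp_one_lt_d9
    have hq : 44 ^ 4 * t ^ 2 * Real.exp 1 < 1 := by
      have ht2 : t ^ 2 ≤ (1 / 4000) ^ 2 := pow_le_pow_left₀ ht0.le ht1 2
      nlinarith [Real.exp_pos 1]
    have hexp : Real.exp L = Real.exp 1 ^ L := by
      rw [← Real.exp_nat_mul, mul_one]
    rw [hexp, show 4 * L = 4 * L by rfl, pow_mul, ← mul_pow, pow_mul]
    calc ((44 * t) ^ 4 * Real.exp 1) ^ L = (t ^ 2 * (44 ^ 4 * t ^ 2 * Real.exp 1)) ^ L := by ring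
      _ < (t ^ 2 * 1) ^ L := by
          refine pow_lt_pow_left₀ ?_ (by positivity) (by omega)
          exact mul_lt_mul_of_pos_left hq (by positivity)
      _ = (t ^ 2) ^ L := by rw [mul_one]
  nlinarith

/-! ### The theorem -/

variable {G : Type*} [Group G] [TopologicalSpace G] [IsTopologicalGroup G] [CompactSpace G]
  [MeasurableSpace G] [BorelSpace G] {ρ : G →* Matrix (Fin 1) (Fin 1) ℂ}

omit [TopologicalSpace G] [IsTopologicalGroup G] [CompactSpace G] [MeasurableSpace G]
  [BorelSpace G] in
/-- The witness `P_X - P_Y` is an observable of the INNER diagonal half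
`{0 ≤ (x₀ - x₁) mod L < L/2}`: both columns `X = (c-1, 0)`, `Y = (-2, c-1)` lie at level
`c - 1 < c = L/2`. -/
theorem isInnerHalfObservable_polDiff_even (c : ℕ) (hL : L = 2 * c) (hc : 3 ≤ c) :
    IsInnerHalfObservable (0 : Fin 3) 1
      (polDiff ρ (colXe (L := L) c) (colYe c) : GaugeConfig 3 L G → ℂ) := by
  have hlev : ((c : ZMod L) - 1).val < L / 2 := by
    rw [show (c : ZMod L) - 1 = ((c - 1 : ℕ) : ZMod L) by rw [Nat.cast_sub (by omega), Nat.cast_one],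
      ZMod.val_natCast, Nat.mod_eq_of_lt (by omega)]
    omega
  have hY : (-2 : ZMod L) - ((c : ZMod L) - 1) = (c : ZMod L) - 1 := by
    have h : ((2 * c : ℕ) : ZMod L) = 0 := by rw [← hL, ZMod.natCast_self]
    push_cast at h
    linear_combination -h
  intro U V hUV
  have key : ∀ A : ZMod L × ZMod L, A.1 - A.2 = (c : ZMod L) - 1 →
      ∀ e : Edge 3 L, ccnt A e ≠ 0 → U e = V e := by
    intro A hA e he
    obtain ⟨h2, h0, h1⟩ := ccnt_ne_zero he
    refine hUV e ?_ ?_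
    · rw [h0, h1, hA]
      exact hlev
    · rw [h2, WilsonRP.shift_apply_of_ne e.1 (show (0 : Fin 3) ≠ 2 by decide),
        WilsonRP.shift_apply_of_ne e.1 (show (1 : Fin 3) ≠ 2 by decide), h0, h1, hA]
      exact hlev
  exact polDiff_congr _ _ fun e he =>
    he.elim (key (colXe c) (by simp [colXe]) e) (key (colYe c) (by simpa [colYe] using hY) e)

/-- **L3(ν), even tori: inner-half diagonal reflection positivity FAILS on every even three-torus
`L ≥ 6`, uniformly.** For every even `L ≥ 6`, every compact group `G`, every continuous
one-dimensional representation `ρ` with values in `{1, -1}` attaining `-1` and every coupling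
`0 < β ≤ 1/5000` (a window independent of `L`), `InnerDiagonalRP (d := 3) (L := L) ρ β 0 1` —
which L3(η) proves in `d = 2` for all even `L ≥ 4`, all compact `G`, all continuous `ρ`, all
`β ≥ 0` — is FALSE. Witness: `F = P_{(c-1,0)} - P_{(-2,c-1)}`, `L = 2c`, two Polyakov loops in
the spectator direction strictly inside the half; cross terms `≥ t^{2L} 𝐙` (two-ladder bands),
diagonal terms `≤ (44t)^{4L} e^L 𝐙` (`4L` line cuts), `t = tanh β`. -/
theorem not_innerDiagonalRP_even (hLeven : Even L) (h6 : 6 ≤ L) (hρ : Continuous ρ)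
    (hval : ∀ g, ρ g = 1 ∨ ρ g = -1) (hne : ∃ g, ρ g = -1) {β : ℝ} (hβ : 0 < β)
    (hβ1 : β ≤ 1 / 5000) :
    ¬ InnerDiagonalRP (d := 3) (L := L) ρ β 0 1 := by
  obtain ⟨c, hc⟩ := hLeven
  have hL : L = 2 * c := by omega
  have hc3 : 3 ≤ c := by omega
  intro hRP
  have ht0 : 0 < Real.tanh β := by
    rw [Real.tanh_eq_sinh_div_cosh]
    exact div_pos (Real.sinh_pos_iff.2 hβ) (Real.cosh_pos β)
  have ht1 : Real.tanh β ≤ 1 / 4000 := by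
    have h := tanh_le_add_sq hβ.le (by linarith)
    nlinarith [mul_le_mul hβ1 hβ1 hβ.le (by norm_num : (0 : ℝ) ≤ 1 / 5000)]
  exact not_nonneg_wilsonExpectation_polDiff hρ hval hne β (colXe (L := L) c) (colYe c)
    (combination_neg_even ht0 ht1 c hL hc3)
    (hRP _ (measurable_polDiff hρ _ _) ⟨2, norm_polDiff_le hval _ _⟩
      (isInnerHalfObservable_polDiff_even c hL hc3))

/-- **`ℤ₂` lattice gauge theory violates inner-half diagonal RP on every even three-torus**
`(ℤ/L)³`, `L ≥ 6` even, for every `0 < β ≤ 1/5000` (`G = ℤˣ`, `ρ = signRepIntUnits`): the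
theorem `not_innerDiagonalRP_even` is not vacuous. -/
theorem not_innerDiagonalRP_even_intUnits (hLeven : Even L) (h6 : 6 ≤ L) {β : ℝ} (hβ : 0 < β)
    (hβ1 : β ≤ 1 / 5000) :
    ¬ InnerDiagonalRP (d := 3) (L := L) signRepIntUnits β 0 1 :=
  not_innerDiagonalRP_even hLeven h6 continuous_of_discreteTopology signRepIntUnits_eq_one_or
    ⟨-1, signRepIntUnits_neg_one⟩ hβ hβ1

end Even

end DiagRPThree

end Summit.QuantumFields.GaugeBoot
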